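import Literature.MathematicalPhysics.QuantumFieldTheory.SpeciesTimeReflection
import HarnessLib

/-!
# Time-chirality of Wilson's corner action density under the site reflection

Companion of `SpeciesTimeReflection.lean` (site time reflection `Θ₀ = cfgReflect` of `ℤ⁴` gauge fields:
spatial links `(x, i) ↦ U(θ₀x, i)`, temporal links `(x, 0) ↦ U(θ₀x − e₀, 0)⁻¹`, `θ₀(x⁰, x⃗) = (−x⁰, x⃗)`).
The corner action density `actionDensity ρ = ∑_{μ<ν} Re tr ρ(U_{∂p_{μν}(0)})` (the curvature species of
`YangMillsOS`) is NOT `Θ₀`-invariant: the three magnetic corner plaquettes (`0 < μ < ν`) lie in the time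
slice `x⁰ = 0` and are fixed, but the three electric ones (`μ = 0 < ν`) sit ABOVE the corner (times `0 … 1`)
and are reflected to the electric plaquettes BELOW it (times `−1 … 0`), i.e. to the electric plaquettes of the
translated field `configShift e₀ U` (up to reversal of orientation and a conjugation, both invisible to
`Re tr ρ` for a continuous representation of a compact group). Content (all proved):

* `siteReflect_zero`, `siteReflect_single_of_ne` — `θ₀` fixes the origin and the spatial unit vectors;
* `plaquetteObs_zero_cfgReflect_of_ne` — magnetic corner plaquettes are `Θ₀`-invariant;
* `plaquetteObs_zero_zero_cfgReflect` — `Re tr ρ((Θ₀U)_{p_{0ν}(0)}) = Re tr ρ((τU)_{p_{0ν}(0)})`,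
  `τ = configShift e₀` (the plaquette one step down in time);
* `actionDensity_eq_sum_subtype` — the corner density as a sum over the six ordered planes `μ < ν`;
* `actionDensity_cfgReflect` — the chirality formula: `actionDensity ρ (Θ₀U) = ∑_{μ<ν} Re tr ρ(V^{μν}_{p_{μν}(0)})`
  with `V^{μν} = configShift e₀ U` for `μ = 0` and `V^{μν} = U` otherwise.

This defect (electric part read one step down) is what makes Wilson-lattice reflection positivity of smeared
CORNER densities only approximate (`O(a)` after smearing with a test function); see Osterwalder–Seiler 1978 §2
for the reflection and the invariance of `Re tr`. Nothing about measures is used or asserted here.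
-/

noncomputable section

open Literature.Probability Literature.MathematicalPhysics.QuantumLattice

namespace Literature.MathematicalPhysics.QuantumFieldTheory

/-! ### The site reflection on the origin and on spatial unit vectors -/

/-- `θ₀` fixes the origin of `ℤ⁴`. [folklore] -/
@[simp] theorem siteReflect_zero : siteReflect (0 : LatticeModels.Site 4) = 0 := by
  funext k
  rw [siteReflect_apply_ite]
  split_ifs <;> simp

/-- `θ₀` fixes the spatial unit vectors `eᵢ`, `i ≠ 0`. [folklore] -/
theorem siteReflect_single_of_ne {i : Fin 4} (hi : i ≠ 0) :
    siteReflect (Pi.single i (1 : ℤ) : LatticeModels.Site 4) = Pi.single i 1 := by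
  have h := siteReflect_add_single_of_ne (0 : LatticeModels.Site 4) hi
  rwa [siteReflect_zero, zero_add] at h

/-- `θ₀ e₀ = −e₀`. [folklore] -/
theorem siteReflect_single_zero :
    siteReflect (Pi.single 0 (1 : ℤ) : LatticeModels.Site 4) = -Pi.single 0 1 := by
  funext k
  rw [siteReflect_apply_ite]
  by_cases hk : k = 0
  · subst hk; simp
  · simp [hk]

/-! ### Corner plaquettes under the reflection -/

section Plaquettes

variable {G : Type} [Group G] [MeasurableSpace G] {N : ℕ} (ρ : G →* Matrix (Fin N) (Fin N) ℂ)

omit [MeasurableSpace G] in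
/-- **Magnetic corner plaquettes are `Θ₀`-invariant**: for `i, j ≠ 0` the plaquette at the origin in the
`(i, j)` plane reads only spatial links in the slice `x⁰ = 0`, which `Θ₀` fixes. [folklore] -/
theorem plaquetteObs_zero_cfgReflect_of_ne {i j : Fin 4} (hi : i ≠ 0) (hj : j ≠ 0) (U : LGConfig 4 G) :
    plaquetteObs ρ 0 i j (cfgReflect U) = plaquetteObs ρ 0 i j U := by
  unfold plaquetteObs plaquetteHolonomyZd
  simp only [cfgReflect, reflectEdge, hi, hj, ↓reduceIte, zero_add, siteReflect_zero,
    siteReflect_single_of_ne hi, siteReflect_single_of_ne hj]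

variable [TopologicalSpace G] [IsTopologicalGroup G] [CompactSpace G]

/-- **Electric corner plaquettes are read one step down**: for `j ≠ 0` and a continuous representation
`ρ` of the compact group `G`, `Re tr ρ((Θ₀U)_{p_{0j}(0)}) = Re tr ρ((configShift e₀ U)_{p_{0j}(0)})` — the
reflected holonomy is a conjugate of the inverse of the holonomy of the plaquette based at `−e₀`, and
`Re tr ρ(g⁻¹) = Re tr ρ(g)`, `tr ρ(hgh⁻¹) = tr ρ(g)`. [cite: OsterwalderSeiler1978, §2] -/
theorem plaquetteObs_zero_zero_cfgReflect (hρ : Continuous ρ) {j : Fin 4} (hj : j ≠ 0) (U : LGConfig 4 G) :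
    plaquetteObs ρ 0 0 j (cfgReflect U) = plaquetteObs ρ 0 0 j (configShift (Pi.single 0 1) U) := by
  unfold plaquetteObs plaquetteHolonomyZd
  simp only [cfgReflect, reflectEdge, hj, ↓reduceIte, zero_add, siteReflect_zero,
    siteReflect_single_of_ne hj, siteReflect_single_zero, zero_sub, inv_inv, configShift_apply,
    sub_self]
  set g : G := U (-Pi.single 0 1, 0) with hg
  set a : G := U (-Pi.single 0 1, j)
  set b : G := U (Pi.single j 1 - Pi.single 0 1, 0)
  set c : G := U (0, j)
  have h1 : g⁻¹ * a * b * c⁻¹ = g⁻¹ * (g * c * b⁻¹ * a⁻¹)⁻¹ * g⁻¹⁻¹ := by group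
  rw [h1, Literature.RepresentationTheory.CompactGroups.CompactGroup.trace_conj_eq,
    Literature.RepresentationTheory.CompactGroups.CompactGroup.re_trace_map_inv ρ hρ]

/-! ### The corner action density -/

omit [MeasurableSpace G] [TopologicalSpace G] [IsTopologicalGroup G] [CompactSpace G] in
/-- The corner action density as a sum over the six ordered coordinate planes `μ < ν` (the index type of
Wave 0's plaquettes). [folklore] -/
theorem actionDensity_eq_sum_subtype (U : LGConfig 4 G) :
    actionDensity ρ U = ∑ q : {q : Fin 4 × Fin 4 // q.1 < q.2}, plaquetteObs ρ 0 q.1.1 q.1.2 U := by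
  symm
  calc ∑ q : {q : Fin 4 × Fin 4 // q.1 < q.2}, plaquetteObs ρ 0 q.1.1 q.1.2 U
      = ∑ q ∈ Finset.univ.filter (fun q : Fin 4 × Fin 4 => q.1 < q.2), plaquetteObs ρ 0 q.1 q.2 U :=
        (Finset.sum_subtype (Finset.univ.filter fun q : Fin 4 × Fin 4 => q.1 < q.2)
          (fun q => by simp) (fun q : Fin 4 × Fin 4 => plaquetteObs ρ 0 q.1 q.2 U)).symm
    _ = actionDensity ρ U := by
        rw [Finset.sum_filter, Fintype.sum_prod_type]
        rfl

/-- **Time-chirality of the corner action density**: on the reflected field the corner density is the sum of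
the magnetic corner plaquettes of `U` and the electric corner plaquettes of the translate `configShift e₀ U`
(the electric part read one lattice step down in time). [cite: OsterwalderSeiler1978, §2] -/
theorem actionDensity_cfgReflect (hρ : Continuous ρ) (U : LGConfig 4 G) :
    actionDensity ρ (cfgReflect U) =
      ∑ q : {q : Fin 4 × Fin 4 // q.1 < q.2},
        plaquetteObs ρ 0 q.1.1 q.1.2 (if q.1.1 = 0 then configShift (Pi.single 0 1) U else U) := by
  rw [actionDensity_eq_sum_subtype]
  refine Finset.sum_congr rfl fun q _ => ?_
  obtain ⟨⟨i, j⟩, hij⟩ := q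
  have hj : j ≠ 0 := fun h => by subst h; exact (Fin.not_lt_zero i) hij
  by_cases hi : i = 0
  · subst hi
    simp only [↓reduceIte]
    exact plaquetteObs_zero_zero_cfgReflect ρ hρ hj U
  · simp only [hi, ↓reduceIte]
    exact plaquetteObs_zero_cfgReflect_of_ne ρ hi hj U

end Plaquettes

end Literature.MathematicalPhysics.QuantumFieldTheory

end
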